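import Mathlib.NumberTheory.ModularForms.EisensteinSeries.QExpansion
import Mathlib.NumberTheory.ModularForms.Bounds
import Mathlib.NumberTheory.LSeries.Convergence
import Mathlib.NumberTheory.ModularForms.LevelOne.DimensionFormula
import Mathlib.Analysis.PSeries
import HarnessLib

/-!
# Apostol, Theorem 6.18: the coefficients of a level-one modular form of weight `k` are `O(n^{k−1})`

T. M. Apostol, *Modular Functions and Dirichlet Series in Number Theory* (GTM 41, 1990), §6.15 (held p0113):

* **Theorem 6.17.** "If `f ∈ M_{k,0}` [a cusp form of weight `k`] … `c(n) = O(n^{k/2})`." — this is Hecke's bound,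
  Mathlib's `CuspFormClass.qExpansion_isBigO`.
* **Theorem 6.18.** "If `f ∈ M_k` and `f` is not a cusp form, then `c(n) = O(n^{k−1})`."  PROOF (printed): `f = λG_k + g`
  with `g` a cusp form, the coefficients of `G_k` are a constant multiple of
  `σ_{k−1}(n) = Σ_{d|n} (n/d)^{k−1} = n^{k−1} Σ_{d|n} d^{−(k−1)} ≤ n^{k−1} Σ_{d=1}^{∞} d^{−(k−1)} = O(n^{k−1})`, and the cusp
  part is `O(n^{k/2}) = O(n^{k−1})`.

Consequence used by the sequel (`LevelOneHeckeFunctionalEquation`): the Dirichlet series `φ(s) = Σ c(n)n^{−s}` of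
§6.16 (50) converges absolutely for `σ > k` ("defined for `σ > k`", Thm. 6.20).

## Contents (theorems only)

* `sigma_le_tsum_mul_pow` — `σ_j(n) ≤ ζ(j) n^j` for `j ≥ 2` (the displayed estimate);
* `qExpansion_coeff_E_isBigO` — the coefficients of Mathlib's normalised Eisenstein series `E_k` are `O(n^{k−1})`;
* `qExpansion_coeff_isBigO_rpow_sub_one` — **Theorem 6.18** for every `f ∈ M_k(SL₂(ℤ))`, `k ≥ 3` (cusp forms
  included, by Thm. 6.17 and `k/2 ≤ k − 1`);
* `LSeriesSummable_qExpansion_coeff_of_lt_re` — absolute convergence of `φ(s)` for `σ > k` (`k ≥ 3`), and the abscissa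
  bound `abscissaOfAbsConv ≤ k` (the Euler product of `LevelOneEigenformEulerProduct` then holds on `σ > k`).

## References

* [Apostol1990] T. M. Apostol, *Modular Functions and Dirichlet Series in Number Theory*, GTM 41 (1990), §6.15
  Thms. 6.17–6.18 (p. 135), §6.16 (50).
-/

noncomputable section

open scoped MatrixGroups ModularForm ArithmeticFunction.sigma
open Complex Filter Asymptotics ArithmeticFunction
open UpperHalfPlane hiding I

namespace Literature.NumberTheory.ModularForms

/-! ## §1 `σ_j(n) ≤ ζ(j) n^j` -/

/-- **`σ_j(n) = n^j Σ_{d|n} d^{−j} ≤ n^j Σ_{d≥1} d^{−j}`** for `j ≥ 2` (the estimate displayed in the proof of Thm. 6.18;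
the constant is `ζ(j) = Σ' d, 1/d^j`, the term `d = 0` contributing `0`). [cite: Apostol1990, proof of Thm. 6.18] -/
theorem sigma_le_tsum_mul_pow {j : ℕ} (hj : 2 ≤ j) (n : ℕ) :
    (σ j n : ℝ) ≤ (∑' d : ℕ, 1 / (d : ℝ) ^ j) * (n : ℝ) ^ j := by
  have hsum : Summable (fun d : ℕ => 1 / (d : ℝ) ^ j) := Real.summable_one_div_nat_pow.mpr (by omega)
  rw [sigma_eq_sum_div, Nat.cast_sum]
  have hterm : ∀ d ∈ n.divisors, (((n / d) ^ j : ℕ) : ℝ) = 1 / (d : ℝ) ^ j * (n : ℝ) ^ j := by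
    intro d hd
    have hd' : d ∣ n := Nat.dvd_of_mem_divisors hd
    have hd0 : d ≠ 0 := Nat.ne_of_gt (Nat.pos_of_mem_divisors hd)
    rw [Nat.cast_pow, Nat.cast_div hd' (by exact_mod_cast hd0), div_pow]
    ring
  rw [Finset.sum_congr rfl hterm, ← Finset.sum_mul]
  gcongr
  exact hsum.sum_le_tsum _ fun d _ => by positivity

/-- `σ_j(n) = O(n^j)` for `j ≥ 2`. [cite: Apostol1990, proof of Thm. 6.18] -/
theorem sigma_isBigO_pow {j : ℕ} (hj : 2 ≤ j) :
    (fun n : ℕ => (σ j n : ℝ)) =O[atTop] fun n : ℕ => (n : ℝ) ^ j := by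
  refine IsBigO.of_bound (∑' d : ℕ, 1 / (d : ℝ) ^ j) (Eventually.of_forall fun n => ?_)
  rw [Real.norm_of_nonneg (Nat.cast_nonneg _), Real.norm_of_nonneg (by positivity)]
  exact sigma_le_tsum_mul_pow hj n

/-! ## §2 The Eisenstein part -/

/-- **The coefficients of the normalised Eisenstein series `E_k` are `O(n^{k−1})`** (`k ≥ 3` even): for `n ≥ 1` they
are `−(2k/B_k) σ_{k−1}(n)` (Mathlib `EisensteinSeries.E_qExpansion_coeff`). [cite: Apostol1990, proof of Thm. 6.18] -/
theorem qExpansion_coeff_E_isBigO {k : ℕ} (hk : 3 ≤ k) (hk2 : Even k) :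
    (fun n : ℕ => (qExpansion 1 (ModularForm.E hk)).coeff n) =O[atTop] fun n : ℕ => (n : ℝ) ^ ((k : ℝ) - 1) := by
  have h1 : (fun n : ℕ => (qExpansion 1 (ModularForm.E hk)).coeff n) =ᶠ[atTop]
      fun n : ℕ => -(2 * k / bernoulli k : ℂ) * (σ (k - 1) n : ℂ) := by
    filter_upwards [eventually_gt_atTop 0] with n hn
    rw [EisensteinSeries.E_qExpansion_coeff hk hk2, if_neg hn.ne']
  refine (IsBigO.congr' (IsBigO.const_mul_left ?_ _) h1.symm EventuallyEq.rfl)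
  have h2 : (fun n : ℕ => (σ (k - 1) n : ℂ)) =O[atTop] fun n : ℕ => (σ (k - 1) n : ℝ) :=
    IsBigO.of_bound 1 (Eventually.of_forall fun n => by simp)
  refine h2.trans ((sigma_isBigO_pow (j := k - 1) (by omega)).trans ?_)
  refine IsBigO.of_bound 1 (Eventually.of_forall fun n => ?_)
  rw [one_mul, Real.norm_of_nonneg (by positivity), Real.norm_of_nonneg (by positivity),
    ← Real.rpow_natCast, Nat.cast_sub (by omega), Nat.cast_one]

/-! ## §3 Theorem 6.18 -/

/-- `n^{k/2} = O(n^{k−1})` for `k ≥ 2` (the cusp part is absorbed: "`O(n^{2k−1}) + O(n^k) = O(n^{2k−1})`" in Apostol's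
weight-`2k` notation). [cite: Apostol1990, proof of Thm. 6.18] -/
theorem rpow_half_isBigO_rpow_sub_one {k : ℤ} (hk : 2 ≤ k) :
    (fun n : ℕ => (n : ℝ) ^ ((k : ℝ) / 2)) =O[atTop] fun n : ℕ => (n : ℝ) ^ ((k : ℝ) - 1) := by
  refine IsBigO.of_bound 1 ?_
  filter_upwards [eventually_ge_atTop 1] with n hn
  rw [one_mul, Real.norm_of_nonneg (by positivity), Real.norm_of_nonneg (by positivity)]
  have hk' : (2 : ℝ) ≤ k := by exact_mod_cast hk
  exact Real.rpow_le_rpow_of_exponent_le (by exact_mod_cast hn) (by linarith)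

/-- **Hecke's bound in the weaker form `O(n^{k−1})`** for a level-one cusp form of weight `k ≥ 2` (Thm. 6.17 and
`k/2 ≤ k − 1`). [cite: Apostol1990, Thm. 6.17] -/
theorem qExpansion_coeff_cuspForm_isBigO_rpow_sub_one {k : ℤ} (hk : 2 ≤ k) (f : CuspForm 𝒮ℒ k) :
    (fun n : ℕ => (qExpansion 1 f).coeff n) =O[atTop] fun n : ℕ => (n : ℝ) ^ ((k : ℝ) - 1) := by
  have hO := CuspFormClass.qExpansion_isBigO f
  rw [Subgroup.strictWidthInfty_SL2Z] at hO
  exact hO.trans (rpow_half_isBigO_rpow_sub_one hk)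

/-- **Theorem 6.18 for weight `k ≥ 3` (natural-number weight, the Eisenstein decomposition).** For every
`f ∈ M_k(SL₂(ℤ))`, `c(n) = O(n^{k−1})`: write `f = c(0)E_k + g` with `g` a cusp form (Mathlib `ModularForm.toCuspForm`),
use §2 for `E_k` and Thm. 6.17 for `g`. (For odd `k` the space is zero.) [cite: Apostol1990, Thm. 6.18] -/
theorem qExpansion_coeff_isBigO_rpow_sub_one_nat {k : ℕ} (hk : 3 ≤ k) (f : ModularForm 𝒮ℒ (k : ℤ)) :
    (fun n : ℕ => (qExpansion 1 f).coeff n) =O[atTop] fun n : ℕ => (n : ℝ) ^ ((k : ℝ) - 1) := by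
  rcases Nat.even_or_odd k with hk2 | hko
  · -- `f = c₀ • E_k + g`, `g` cuspidal
    set c₀ : ℂ := (qExpansion 1 f).coeff 0 with hc₀
    set g : ModularForm 𝒮ℒ (k : ℤ) := f - c₀ • ModularForm.E hk with hg
    have hgq : qExpansion 1 g = qExpansion 1 f - c₀ • qExpansion 1 (ModularForm.E hk) := by
      rw [hg, ModularForm.coe_sub, ModularForm.qExpansion_sub one_pos one_mem_strictPeriods_SL,
        ModularForm.IsGLPos.coe_smul, ModularForm.qExpansion_smul one_pos one_mem_strictPeriods_SL]
    have hg0 : (qExpansion 1 g).coeff 0 = 0 := by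
      rw [hgq, map_sub, map_smul, EisensteinSeries.E_qExpansion_coeff_zero hk hk2, smul_eq_mul, mul_one, hc₀,
        sub_self]
    have hgO := qExpansion_coeff_cuspForm_isBigO_rpow_sub_one (k := (k : ℤ)) (by exact_mod_cast (by omega : 2 ≤ k))
      (ModularForm.toCuspForm g hg0)
    have hcoe : (⇑(ModularForm.toCuspForm g hg0) : ℍ → ℂ) = ⇑g := rfl
    rw [hcoe] at hgO
    have hEO := (qExpansion_coeff_E_isBigO hk hk2).const_mul_left c₀
    have hsum := hEO.add hgO
    refine (hsum.congr' (Eventually.of_forall fun n => ?_) EventuallyEq.rfl).congr_right ?_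
    · simp only [hgq, map_sub, map_smul, smul_eq_mul]
      ring
    · intro n
      simp
  · have hf : f = 0 := ModularForm.levelOne_odd_weight_eq_zero (by exact_mod_cast hko) f
    subst hf
    simpa [qExpansion_zero] using isBigO_zero (fun n : ℕ => (n : ℝ) ^ ((k : ℝ) - 1)) atTop

/-- **Apostol, Theorem 6.18 (with Thm. 6.17): the coefficients of a level-one modular form of weight `k ≥ 3` are
`O(n^{k−1})`.** [cite: Apostol1990, Thm. 6.18] -/
theorem qExpansion_coeff_isBigO_rpow_sub_one {k : ℤ} (hk : 3 ≤ k) (f : ModularForm 𝒮ℒ k) :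
    (fun n : ℕ => (qExpansion 1 f).coeff n) =O[atTop] fun n : ℕ => (n : ℝ) ^ ((k : ℝ) - 1) := by
  obtain ⟨m, rfl⟩ := Int.eq_ofNat_of_zero_le (by omega : (0 : ℤ) ≤ k)
  have h := qExpansion_coeff_isBigO_rpow_sub_one_nat (k := m) (by exact_mod_cast hk) f
  simpa only [Int.cast_natCast] using h

/-! ## §4 Absolute convergence of `φ(s)` for `σ > k` -/

/-- **`φ(s) = Σ c(n) n^{−s}` converges absolutely for `σ > k`** (`f ∈ M_k(SL₂(ℤ))`, `k ≥ 3`; "the function defined for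
`σ > k` by the Dirichlet series (50)", from Thm. 6.18). [cite: Apostol1990, §6.16 (50) and Thm. 6.20 (hypothesis `σ > k`)] -/
theorem LSeriesSummable_qExpansion_coeff_of_lt_re {k : ℤ} (hk : 3 ≤ k) (f : ModularForm 𝒮ℒ k) {s : ℂ}
    (hs : (k : ℝ) < s.re) : LSeriesSummable (fun n => (qExpansion 1 f).coeff n) s :=
  LSeriesSummable_of_isBigO_rpow (x := (k : ℝ)) hs (qExpansion_coeff_isBigO_rpow_sub_one hk f)

/-- The abscissa of absolute convergence of `φ` is at most `k` (`k ≥ 3`). [cite: Apostol1990, §6.16 (50)] -/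
theorem abscissaOfAbsConv_qExpansion_coeff_le_weight {k : ℤ} (hk : 3 ≤ k) (f : ModularForm 𝒮ℒ k) :
    LSeries.abscissaOfAbsConv (fun n => (qExpansion 1 f).coeff n) ≤ (k : ℝ) :=
  LSeries.abscissaOfAbsConv_le_of_forall_lt_LSeriesSummable fun _ hy =>
    LSeriesSummable_qExpansion_coeff_of_lt_re hk f (by rwa [ofReal_re])

end Literature.NumberTheory.ModularForms
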